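import Mathlib.MeasureTheory.Group.FundamentalDomain
import Mathlib.MeasureTheory.Group.Measure
import Mathlib.MeasureTheory.Measure.Prod
import Mathlib.Topology.Algebra.InfiniteSum.ENNReal
import Literature.MeasureTheory.Group.DiscreteFundamentalDomain
import HarnessLib

/-!
# Covering weights: integrals over quotients by discrete groups without quotient spaces
(Weil, *L'intégration dans les groupes topologiques* (1940), §9; Bourbaki, *Intégration* VII §2,
no. 3–4; Raghunathan, *Discrete subgroups of Lie groups* (1972), Ch. I §1.4)

Topic `MeasureTheory/Group`; namespace `Literature.MeasureTheory.Group`. The unfolding arguments of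
the Rankin–Selberg method on `GL_n(𝔸_K)` (Jacquet–Shalika (1981), §4; Cogdell (2004), §2.3) run
through a chain of quotients `Γ₁\G, Γ₂\G, …` by *different* discrete subgroups of `G(K)` and by
non-discrete groups `Γ ⋉ U(𝔸)` (`U` unipotent). Rather than constructing an invariant measure on
each coset space, this file records the classical device of **smooth fundamental domains**
("weights"): for a countable group `Γ` acting measurably on a measure space `(X, ν)` preserving `ν`,
a measurable `β : X → [0, ∞]` with `∑_{γ ∈ Γ} β(γ • x) = 1` for all `x` (`IsCoveringWeight`) turns
`∫_X F β dν` into the integral of a `Γ`-invariant `F ≥ 0` over `Γ\X`, *independently of `β`*.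
Everything is a Tonelli computation; all statements are proved (Mathlib only, plus the strict
fundamental domains of `DiscreteFundamentalDomain` for the existence statement):

* `coveringSum Γ β x = ∑_{γ} β(γ • x)`; `coveringSum_smul` (it is `Γ`-invariant);
  `measurable_coveringSum`.
* `lintegral_mul_mul_coveringSum_comm` — **the exchange identity**
  `∫ F β₁ (Σ_γ β₂(γ•·)) dν = ∫ F β₂ (Σ_γ β₁(γ•·)) dν` for `Γ`-invariant `F` (Tonelli and the change of
  variables `x ↦ γ⁻¹ • x`), whence `lintegral_mul_eq_of_coveringSum_eq` — **independence of the
  weight**: if `Σ_γ β₁(γ•x) = Σ_γ β₂(γ•x) = c ∈ (0, ∞)` for all `x` then `∫ F β₁ = ∫ F β₂`.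
* `lintegral_mul_le_inv_mul_setLIntegral_of_le_coveringSum_indicator` — **domination by a covering
  set**: if every orbit meets `S` with multiplicity `≥ c₀ > 0` and `Σ_γ β(γ•x) ≤ 1`, then
  `∫ F β dν ≤ c₀⁻¹ ∫_S F dν` for `Γ`-invariant `F ≥ 0` (the reduction-theory step).
* `IsCoveringWeight`; `isCoveringWeight_indicator` (the indicator of a strict fundamental domain
  `∀ x, ∃! γ, γ • x ∈ 𝓕` is a weight) and `exists_isCoveringWeight` — **existence** for a discrete
  subgroup of a second countable group acting by left multiplication
  (`Subgroup.exists_measurableSet_existsUnique_smul_mem`).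
* `lintegral_mul_eq_lintegral_tsum_mul` — **unfolding to a subgroup** `Γ' ≤ Γ ≤ G` (`G` acting on
  `X`): for a `Γ'`-invariant `F`, a `Γ'`-weight `β'`, a `Γ`-weight `β` and representatives `s i ∈ Γ`
  of the right cosets `Γ' \ Γ` (`∀ γ ∈ Γ, ∃! i, γ (s i)⁻¹ ∈ Γ'`), `∫ F β' dν = ∫ (Σ_i F(s i • ·)) β dν`
  — the unfolding `∫_{Γ'\X} F = ∫_{Γ\X} Σ_{Γ'\Γ} F(γ ·)`.
* `semidirectCoveringLIntegral Γ U μU β x = Σ_{γ ∈ Γ} ∫_U β(γ • u • x) dμU` — the fibre functional of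
  a group `Γ · U` (`Γ, U ≤ G`, `G` acting on `X`, `μU` a σ-finite measure on `U`), and
  `lintegral_mul_mul_semidirectCoveringLIntegral_comm`, `lintegral_mul_eq_of_semidirectCoveringLIntegral_eq`
  — the exchange identity and the independence of the weight for functions invariant under `Γ` and
  under `U`, under the two hypotheses used in practice: `μU` is inversion invariant, and `Γ` and `U`
  commute in the mean (`∫_U f(γ • u • x) = ∫_U f(u • γ • x)`, i.e. `Γ` normalises `U` preserving `μU`).

## Design notes

* No topology, no quotient type, no Haar measure on `Γ` or on `Γ U`: the hypotheses are the
  invariance of `ν` (`SMulInvariantMeasure`) and measurability of the translations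
  (`MeasurableConstSMul`); the fibre sums are `tsum`s in `[0, ∞]`, so no summability bookkeeping.
* The constant `c` of `lintegral_mul_eq_of_coveringSum_eq` is arbitrary in `(0, ∞)` (weights of total
  mass `c`), which is the form produced by unfolding a unipotent lattice (`c = vol(U(K)\U(𝔸))`).

## References

* A. Weil, *L'intégration dans les groupes topologiques et ses applications* (1940), §9.
* N. Bourbaki, *Intégration*, Ch. VII, §2, no. 3–4 (quasi-invariant measures on homogeneous spaces;
  smooth partitions of unity along a closed subgroup).
* M. S. Raghunathan, *Discrete subgroups of Lie groups* (1972), Ch. I, §1.4.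
* J. W. Cogdell, *Analytic theory of L-functions for GL_n*, in *An Introduction to the Langlands
  Program* (2004), §2.3 (the unfoldings of the Rankin–Selberg integral) [CogdellAnalyticTheory2004].
-/

noncomputable section

open _root_.MeasureTheory _root_.MeasureTheory.Measure Set Filter Function
open scoped ENNReal NNReal Pointwise

namespace Literature.MeasureTheory.Group

/-! ### Covering sums of a countable group action -/

section CoveringSum

variable {Γ : Type*} [Group Γ] {X : Type*} [MulAction Γ X]

/-- The **covering sum** `Σ_{γ ∈ Γ} β(γ • x) ∈ [0, ∞]` of a function `β : X → [0, ∞]` along the orbit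
of `x` (a `tsum` in `[0, ∞]`, always defined). [folklore] -/
def coveringSum (Γ : Type*) [Group Γ] [MulAction Γ X] (β : X → ℝ≥0∞) (x : X) : ℝ≥0∞ :=
  ∑' γ : Γ, β (γ • x)

/-- `coveringSum Γ β x = ∑' γ, β (γ • x)` (definitional). [folklore] -/
theorem coveringSum_apply (β : X → ℝ≥0∞) (x : X) : coveringSum Γ β x = ∑' γ : Γ, β (γ • x) := rfl

/-- **The covering sum is `Γ`-invariant**: `Σ_γ β(γ γ₀ • x) = Σ_γ β(γ • x)` (reindex by `γ ↦ γ γ₀`).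
[folklore] -/
theorem coveringSum_smul (β : X → ℝ≥0∞) (γ₀ : Γ) (x : X) :
    coveringSum Γ β (γ₀ • x) = coveringSum Γ β x := by
  simp only [coveringSum_apply, smul_smul]
  exact (Equiv.mulRight γ₀).tsum_eq fun γ => β (γ • x)

/-- Covering sums are monotone in the function. [folklore] -/
theorem coveringSum_mono {β β' : X → ℝ≥0∞} (h : β ≤ β') (x : X) :
    coveringSum Γ β x ≤ coveringSum Γ β' x :=
  ENNReal.tsum_le_tsum fun _ => h _

/-- Covering sums commute with constant factors. [folklore] -/
theorem coveringSum_const_mul (c : ℝ≥0∞) (β : X → ℝ≥0∞) (x : X) :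
    coveringSum Γ (fun y => c * β y) x = c * coveringSum Γ β x := by
  simp only [coveringSum_apply, ENNReal.tsum_mul_left]

/-- A `Γ`-invariant factor comes out of the covering sum:
`Σ_γ F(γ•x) β(γ•x) = F(x) Σ_γ β(γ•x)`. [folklore] -/
theorem coveringSum_mul_of_invariant {F : X → ℝ≥0∞} (hF : ∀ (γ : Γ) (x : X), F (γ • x) = F x)
    (β : X → ℝ≥0∞) (x : X) :
    coveringSum Γ (fun y => F y * β y) x = F x * coveringSum Γ β x := by
  simp only [coveringSum_apply, hF, ENNReal.tsum_mul_left]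

variable [MeasurableSpace X] [MeasurableConstSMul Γ X]

/-- Covering sums of measurable functions are measurable (countable `Γ`). [folklore] -/
theorem measurable_coveringSum [Countable Γ] {β : X → ℝ≥0∞} (hβ : Measurable β) :
    Measurable (coveringSum Γ β) :=
  Measurable.tsum fun γ => hβ.comp (measurable_const_smul γ)

variable [Countable Γ] (ν : Measure X) [SMulInvariantMeasure Γ X ν]

/-- **The exchange identity.** For a countable group `Γ` acting measurably on `(X, ν)` preserving
`ν`, a `Γ`-invariant measurable `F ≥ 0` and measurable `β₁, β₂ ≥ 0`:
`∫ F β₁ (Σ_γ β₂(γ•·)) dν = ∫ F β₂ (Σ_γ β₁(γ•·)) dν`. Proof: expand the sum, exchange it with the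
integral (Tonelli), change variables `x ↦ γ⁻¹ • x` in the `γ`-th term (invariance of `ν` and of
`F`), reindex `γ ↦ γ⁻¹`, and exchange back (Bourbaki, *Intégration* VII §2 no. 3, the computation
behind the uniqueness of quasi-invariant measures; Raghunathan (1972), I.1.4). [folklore] -/
theorem lintegral_mul_mul_coveringSum_comm {F β₁ β₂ : X → ℝ≥0∞} (hF : Measurable F)
    (hFinv : ∀ (γ : Γ) (x : X), F (γ • x) = F x) (hβ₁ : Measurable β₁) (hβ₂ : Measurable β₂) :
    ∫⁻ x, F x * β₁ x * coveringSum Γ β₂ x ∂ν = ∫⁻ x, F x * β₂ x * coveringSum Γ β₁ x ∂ν := by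
  have hm₁ : ∀ γ : Γ, Measurable fun x => F x * β₁ x * β₂ (γ • x) := fun γ =>
    (hF.mul hβ₁).mul (hβ₂.comp (measurable_const_smul γ))
  have hm₂ : ∀ γ : Γ, Measurable fun x => F x * β₁ (γ • x) * β₂ x := fun γ =>
    (hF.mul (hβ₁.comp (measurable_const_smul γ))).mul hβ₂
  calc ∫⁻ x, F x * β₁ x * coveringSum Γ β₂ x ∂ν
      = ∫⁻ x, ∑' γ : Γ, F x * β₁ x * β₂ (γ • x) ∂ν := by
        refine lintegral_congr fun x => ?_
        rw [coveringSum_apply, ENNReal.tsum_mul_left]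
    _ = ∑' γ : Γ, ∫⁻ x, F x * β₁ x * β₂ (γ • x) ∂ν :=
        lintegral_tsum fun γ => (hm₁ γ).aemeasurable
    _ = ∑' γ : Γ, ∫⁻ x, F x * β₁ (γ⁻¹ • x) * β₂ x ∂ν := by
        refine tsum_congr fun γ => ?_
        have h := (measurePreserving_smul γ⁻¹ ν).lintegral_comp (hm₁ γ)
        rw [← h]
        refine lintegral_congr fun x => ?_
        rw [smul_inv_smul, hFinv]
    _ = ∑' γ : Γ, ∫⁻ x, F x * β₁ (γ • x) * β₂ x ∂ν :=
        (Equiv.inv Γ).tsum_eq fun γ => ∫⁻ x, F x * β₁ (γ • x) * β₂ x ∂ν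
    _ = ∫⁻ x, ∑' γ : Γ, F x * β₁ (γ • x) * β₂ x ∂ν :=
        (lintegral_tsum fun γ => (hm₂ γ).aemeasurable).symm
    _ = ∫⁻ x, F x * β₂ x * coveringSum Γ β₁ x ∂ν := by
        refine lintegral_congr fun x => ?_
        rw [coveringSum_apply, ← ENNReal.tsum_mul_left]
        refine tsum_congr fun γ => ?_
        ring

/-- **Independence of the weight.** If two measurable `β₁, β₂ ≥ 0` have the same constant covering
sum `c ∈ (0, ∞)` — `Σ_γ β₁(γ•x) = Σ_γ β₂(γ•x) = c` for all `x` — then `∫ F β₁ dν = ∫ F β₂ dν` for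
every `Γ`-invariant measurable `F ≥ 0`: both are `c⁻¹ ∫ F β₁ (Σ_γ β₂(γ•·))` by the exchange identity.
This is the statement that `∫_X F β dν` only depends on the `Γ`-invariant `F`, i.e. is an integral
over `Γ\X` (Weil (1940), §9; Bourbaki, *Intégration* VII §2 no. 4). [folklore] -/
theorem lintegral_mul_eq_of_coveringSum_eq {F β₁ β₂ : X → ℝ≥0∞} (hF : Measurable F)
    (hFinv : ∀ (γ : Γ) (x : X), F (γ • x) = F x) (hβ₁ : Measurable β₁) (hβ₂ : Measurable β₂)
    {c : ℝ≥0∞} (hc₀ : c ≠ 0) (hc : c ≠ ∞) (h₁ : ∀ x, coveringSum Γ β₁ x = c)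
    (h₂ : ∀ x, coveringSum Γ β₂ x = c) :
    ∫⁻ x, F x * β₁ x ∂ν = ∫⁻ x, F x * β₂ x ∂ν := by
  have key := lintegral_mul_mul_coveringSum_comm ν hF hFinv hβ₁ hβ₂
  simp only [h₁, h₂] at key
  have e₁ : ∫⁻ x, F x * β₁ x * c ∂ν = (∫⁻ x, F x * β₁ x ∂ν) * c :=
    lintegral_mul_const c (hF.mul hβ₁)
  have e₂ : ∫⁻ x, F x * β₂ x * c ∂ν = (∫⁻ x, F x * β₂ x ∂ν) * c :=
    lintegral_mul_const c (hF.mul hβ₂)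
  rw [e₁, e₂] at key
  exact (ENNReal.mul_left_inj hc₀ hc).1 key

/-- The same with covering sums that are only constant along the support of `F`: if
`Σ_γ β₁(γ•x) = Σ_γ β₂(γ•x) = c ∈ (0,∞)` whenever `F x ≠ 0`, then `∫ F β₁ = ∫ F β₂`. [folklore] -/
theorem lintegral_mul_eq_of_coveringSum_eq_on {F β₁ β₂ : X → ℝ≥0∞} (hF : Measurable F)
    (hFinv : ∀ (γ : Γ) (x : X), F (γ • x) = F x) (hβ₁ : Measurable β₁) (hβ₂ : Measurable β₂)
    {c : ℝ≥0∞} (hc₀ : c ≠ 0) (hc : c ≠ ∞) (h₁ : ∀ x, F x ≠ 0 → coveringSum Γ β₁ x = c)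
    (h₂ : ∀ x, F x ≠ 0 → coveringSum Γ β₂ x = c) :
    ∫⁻ x, F x * β₁ x ∂ν = ∫⁻ x, F x * β₂ x ∂ν := by
  have key := lintegral_mul_mul_coveringSum_comm ν hF hFinv hβ₁ hβ₂
  have e₁ : (fun x => F x * β₁ x * coveringSum Γ β₂ x) = fun x => F x * β₁ x * c := by
    funext x
    by_cases hx : F x = 0
    · simp [hx]
    · rw [h₂ x hx]
  have e₂ : (fun x => F x * β₂ x * coveringSum Γ β₁ x) = fun x => F x * β₂ x * c := by
    funext x
    by_cases hx : F x = 0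
    · simp [hx]
    · rw [h₁ x hx]
  have e₃ : ∫⁻ x, F x * β₁ x * c ∂ν = (∫⁻ x, F x * β₁ x ∂ν) * c :=
    lintegral_mul_const c (hF.mul hβ₁)
  have e₄ : ∫⁻ x, F x * β₂ x * c ∂ν = (∫⁻ x, F x * β₂ x ∂ν) * c :=
    lintegral_mul_const c (hF.mul hβ₂)
  rw [e₁, e₂, e₃, e₄] at key
  exact (ENNReal.mul_left_inj hc₀ hc).1 key

/-- **Domination by a covering set.** Let `S ⊆ X` be measurable such that every orbit meets `S` with
multiplicity at least `c₀ > 0` — `c₀ ≤ Σ_γ 1_S(γ • x)` for all `x` (e.g. a Siegel set, whose translates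
cover `X`) — and let `β ≥ 0` be measurable with `Σ_γ β(γ • x) ≤ 1` for all `x`. Then for every
`Γ`-invariant measurable `F ≥ 0`, `∫ F β dν ≤ c₀⁻¹ ∫_S F dν`: insert `c₀⁻¹ Σ_γ 1_S(γ•x) ≥ 1`, exchange
(`lintegral_mul_mul_coveringSum_comm`) and bound `Σ_γ β(γ•x) ≤ 1`. This converts integrals over
`Γ\X` into integrals over a set of representatives met finitely often (the reduction-theory step of every
convergence proof for Eisenstein-type series). [folklore] -/
theorem lintegral_mul_le_inv_mul_setLIntegral_of_le_coveringSum_indicator {F β : X → ℝ≥0∞}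
    (hF : Measurable F) (hFinv : ∀ (γ : Γ) (x : X), F (γ • x) = F x) (hβ : Measurable β)
    (hβ1 : ∀ x, coveringSum Γ β x ≤ 1) {S : Set X} (hS : MeasurableSet S) {c₀ : ℝ≥0∞} (hc₀ : c₀ ≠ 0)
    (hc₀top : c₀ ≠ ∞) (hcov : ∀ x, c₀ ≤ coveringSum Γ (S.indicator 1) x) :
    ∫⁻ x, F x * β x ∂ν ≤ c₀⁻¹ * ∫⁻ x in S, F x ∂ν := by
  have hind : Measurable (S.indicator (1 : X → ℝ≥0∞)) := measurable_one.indicator hS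
  -- insert the covering sum of `1_S`
  have h1 : ∫⁻ x, F x * β x ∂ν ≤ ∫⁻ x, F x * β x * (c₀⁻¹ * coveringSum Γ (S.indicator 1) x) ∂ν := by
    refine lintegral_mono fun x => ?_
    have : 1 ≤ c₀⁻¹ * coveringSum Γ (S.indicator 1) x := by
      calc (1 : ℝ≥0∞) = c₀⁻¹ * c₀ := (ENNReal.inv_mul_cancel hc₀ hc₀top).symm
        _ ≤ c₀⁻¹ * coveringSum Γ (S.indicator 1) x := by gcongr; exact hcov x
    calc F x * β x = F x * β x * 1 := (mul_one _).symm
      _ ≤ F x * β x * (c₀⁻¹ * coveringSum Γ (S.indicator 1) x) := by gcongr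
  -- exchange
  have h2 : ∫⁻ x, F x * β x * (c₀⁻¹ * coveringSum Γ (S.indicator 1) x) ∂ν =
      c₀⁻¹ * ∫⁻ x, F x * S.indicator 1 x * coveringSum Γ β x ∂ν := by
    have e : (fun x => F x * β x * (c₀⁻¹ * coveringSum Γ (S.indicator 1) x)) =
        fun x => c₀⁻¹ * (F x * β x * coveringSum Γ (S.indicator 1) x) := by
      funext x; ring
    have hm : Measurable fun x => F x * β x * coveringSum Γ (S.indicator 1) x :=
      (hF.mul hβ).mul (measurable_coveringSum hind)
    have e2 : ∫⁻ x, c₀⁻¹ * (F x * β x * coveringSum Γ (S.indicator 1) x) ∂ν =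
        c₀⁻¹ * ∫⁻ x, F x * β x * coveringSum Γ (S.indicator 1) x ∂ν := lintegral_const_mul c₀⁻¹ hm
    rw [e, e2, lintegral_mul_mul_coveringSum_comm ν hF hFinv hβ hind]
  -- bound the covering sum of `β` by `1`
  have h3 : ∫⁻ x, F x * S.indicator 1 x * coveringSum Γ β x ∂ν ≤ ∫⁻ x in S, F x ∂ν := by
    rw [← lintegral_indicator hS]
    refine lintegral_mono fun x => ?_
    by_cases hx : x ∈ S
    · rw [Set.indicator_of_mem hx, Set.indicator_of_mem hx, Pi.one_apply, mul_one]
      calc F x * coveringSum Γ β x ≤ F x * 1 := by gcongr; exact hβ1 x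
        _ = F x := mul_one _
    · rw [Set.indicator_of_notMem hx, Set.indicator_of_notMem hx, mul_zero, zero_mul]
  calc ∫⁻ x, F x * β x ∂ν ≤ _ := h1
    _ = c₀⁻¹ * ∫⁻ x, F x * S.indicator 1 x * coveringSum Γ β x ∂ν := h2
    _ ≤ c₀⁻¹ * ∫⁻ x in S, F x ∂ν := by gcongr

end CoveringSum

/-! ### Covering weights and their existence -/

section Weight

variable {Γ : Type*} [Group Γ] {X : Type*} [MulAction Γ X] [MeasurableSpace X]

/-- A **covering weight** for the action of `Γ` on `X`: a measurable `β : X → [0, ∞]` with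
`Σ_{γ ∈ Γ} β(γ • x) = 1` for every `x` — a "smooth fundamental domain" (Bourbaki, *Intégration*
VII §2 no. 4; the indicator of a strict fundamental domain is the basic example). [folklore] -/
def IsCoveringWeight (Γ : Type*) [Group Γ] [MulAction Γ X] (β : X → ℝ≥0∞) : Prop :=
  Measurable β ∧ ∀ x, coveringSum Γ β x = 1

/-- A covering weight is measurable. [folklore] -/
theorem IsCoveringWeight.measurable {β : X → ℝ≥0∞} (h : IsCoveringWeight Γ β) : Measurable β :=
  h.1

/-- A covering weight has covering sum `1`. [folklore] -/
theorem IsCoveringWeight.coveringSum_eq {β : X → ℝ≥0∞} (h : IsCoveringWeight Γ β) (x : X) :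
    coveringSum Γ β x = 1 :=
  h.2 x

/-- A covering weight is pointwise at most `1` (one term of a sum equal to `1`). [folklore] -/
theorem IsCoveringWeight.le_one {β : X → ℝ≥0∞} (h : IsCoveringWeight Γ β) (x : X) : β x ≤ 1 := by
  have h1 := h.2 x
  rw [coveringSum_apply] at h1
  calc β x = β ((1 : Γ) • x) := by rw [one_smul]
    _ ≤ ∑' γ : Γ, β (γ • x) := ENNReal.le_tsum (1 : Γ)
    _ = 1 := h1

/-- **The indicator of a strict fundamental domain is a covering weight**: if every orbit meets the
measurable set `𝓕` in exactly one point (`∀ x, ∃! γ, γ • x ∈ 𝓕`), then `Σ_γ 1_𝓕(γ • x) = 1`.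
[folklore] -/
theorem isCoveringWeight_indicator {𝓕 : Set X} (h𝓕 : MeasurableSet 𝓕)
    (huniq : ∀ x : X, ∃! γ : Γ, γ • x ∈ 𝓕) :
    IsCoveringWeight Γ (𝓕.indicator (1 : X → ℝ≥0∞)) := by
  refine ⟨measurable_one.indicator h𝓕, fun x => ?_⟩
  obtain ⟨γ₀, hγ₀, huniq₀⟩ := huniq x
  rw [coveringSum_apply, tsum_eq_single γ₀]
  · rw [Set.indicator_of_mem hγ₀, Pi.one_apply]
  · intro γ hγ
    rw [Set.indicator_of_notMem]
    exact fun hmem => hγ (huniq₀ γ hmem)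

end Weight

section Existence

variable {G : Type*} [Group G] [TopologicalSpace G] [IsTopologicalGroup G]
  [SecondCountableTopology G] [MeasurableSpace G] [BorelSpace G]
  (Γ : Subgroup G) [DiscreteTopology Γ]

/-- **Existence of covering weights** for a discrete subgroup `Γ` of a second countable topological
group `G` acting by left multiplication: the indicator of a strict measurable fundamental domain
(`Subgroup.exists_measurableSet_existsUnique_smul_mem` of `DiscreteFundamentalDomain`).
[folklore] -/
theorem exists_isCoveringWeight : ∃ β : G → ℝ≥0∞, IsCoveringWeight Γ β := by
  obtain ⟨𝓕, h𝓕, huniq⟩ := Subgroup.exists_measurableSet_existsUnique_smul_mem Γ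
  exact ⟨𝓕.indicator 1, isCoveringWeight_indicator h𝓕 huniq⟩

end Existence

/-! ### Unfolding to a subgroup -/

section Unfolding

variable {G : Type*} [Group G] {X : Type*} [MulAction G X] [MeasurableSpace X]
  [MeasurableConstSMul G X] (ν : Measure X) [SMulInvariantMeasure G X ν]
  (Γ Γ' : Subgroup G)

/-- **The unfolded weight.** Given `β` and elements `s i` of `G`, the function
`x ↦ Σ_i β((s i)⁻¹ • x)`. [folklore] -/
def unfoldWeight (β : X → ℝ≥0∞) {ι : Type*} (s : ι → G) (x : X) : ℝ≥0∞ :=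
  ∑' i, β ((s i)⁻¹ • x)

omit [SMulInvariantMeasure G X ν] in
/-- The unfolded weight of a measurable function is measurable (countable index set). [folklore] -/
theorem measurable_unfoldWeight {β : X → ℝ≥0∞} (hβ : Measurable β) {ι : Type*} [Countable ι]
    (s : ι → G) : Measurable (unfoldWeight β s) :=
  Measurable.tsum fun i => hβ.comp (measurable_const_smul (s i)⁻¹)

omit [MeasurableSpace X] [MeasurableConstSMul G X] in
/-- **The unfolded weight is a `Γ'`-weight of the same mass.** Let `Γ' ≤ Γ ≤ G` and let the
`s i ∈ Γ` represent the right cosets of `Γ'` in `Γ` exactly once (`∀ γ ∈ Γ, ∃! i, γ (s i)⁻¹ ∈ Γ'`).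
Then `Σ_{γ' ∈ Γ'} Σ_i β((s i)⁻¹ γ' • x) = Σ_{γ ∈ Γ} β(γ • x)`: the map `(γ', i) ↦ (s i)⁻¹ γ'` is a
bijection `Γ' × ι ≃ Γ`. [folklore] -/
theorem coveringSum_unfoldWeight (hle : Γ' ≤ Γ) (β : X → ℝ≥0∞) {ι : Type*} {s : ι → G}
    (hsΓ : ∀ i, s i ∈ Γ) (hs : ∀ γ ∈ Γ, ∃! i, γ * (s i)⁻¹ ∈ Γ') (x : X) :
    coveringSum Γ' (unfoldWeight β s) x = coveringSum Γ β x := by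
  classical
  -- the bijection `Γ' × ι ≃ Γ`, `(γ', i) ↦ (s i)⁻¹ * γ'`
  let f : Γ' × ι → Γ := fun p => ⟨(s p.2)⁻¹ * (p.1 : G), Γ.mul_mem (Γ.inv_mem (hsΓ p.2)) (hle p.1.2)⟩
  have hsurj : Function.Surjective f := by
    rintro ⟨γ, hγ⟩
    obtain ⟨i, hi, -⟩ := hs γ⁻¹ (Γ.inv_mem hγ)
    refine ⟨(⟨(γ⁻¹ * (s i)⁻¹)⁻¹, Γ'.inv_mem hi⟩, i), Subtype.ext ?_⟩
    simp only [f, mul_inv_rev, inv_inv]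
    rw [← mul_assoc, inv_mul_cancel, one_mul]
  have hinj : Function.Injective f := by
    rintro ⟨γ₁, i₁⟩ ⟨γ₂, i₂⟩ h
    have h' : (s i₁)⁻¹ * (γ₁ : G) = (s i₂)⁻¹ * (γ₂ : G) := congrArg Subtype.val h
    -- `γ := ((s i₁)⁻¹ γ₁)⁻¹ ∈ Γ` has `γ (s i₁)⁻¹ = γ₁⁻¹ ∈ Γ'` and `γ (s i₂)⁻¹ = γ₂⁻¹ ∈ Γ'`
    set γ : G := ((s i₁)⁻¹ * (γ₁ : G))⁻¹ with hγ
    have hγΓ : γ ∈ Γ := Γ.inv_mem (Γ.mul_mem (Γ.inv_mem (hsΓ i₁)) (hle γ₁.2))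
    have h1 : γ * (s i₁)⁻¹ ∈ Γ' := by
      rw [hγ, mul_inv_rev, inv_inv, mul_assoc, mul_inv_cancel, mul_one]
      exact Γ'.inv_mem γ₁.2
    have h2 : γ * (s i₂)⁻¹ ∈ Γ' := by
      rw [hγ, h', mul_inv_rev, inv_inv, mul_assoc, mul_inv_cancel, mul_one]
      exact Γ'.inv_mem γ₂.2
    obtain ⟨i, -, hiu⟩ := hs γ hγΓ
    have hi₁ : i₁ = i := hiu i₁ h1
    have hi₂ : i₂ = i := hiu i₂ h2
    have hii : i₁ = i₂ := hi₁.trans hi₂.symm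
    subst hii
    have hγγ : (γ₁ : G) = γ₂ := mul_left_cancel h'
    exact Prod.ext (Subtype.ext hγγ) rfl
  let e : Γ' × ι ≃ Γ := Equiv.ofBijective f ⟨hinj, hsurj⟩
  calc coveringSum Γ' (unfoldWeight β s) x
      = ∑' (γ' : Γ') (i : ι), β (((s i)⁻¹ * (γ' : G)) • x) := by
        simp only [coveringSum_apply, unfoldWeight, Subgroup.smul_def, smul_smul]
    _ = ∑' p : Γ' × ι, β (((s p.2)⁻¹ * (p.1 : G)) • x) := ENNReal.tsum_prod.symm
    _ = ∑' γ : Γ, β ((γ : G) • x) := e.tsum_eq (fun γ : Γ => β ((γ : G) • x))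
    _ = coveringSum Γ β x := by simp only [coveringSum_apply, Subgroup.smul_def]

/-- **Unfolding to a subgroup.** Let `Γ' ≤ Γ ≤ G` with `Γ` countable, `G` acting measurably on
`(X, ν)` preserving `ν`; `F ≥ 0` measurable and `Γ'`-invariant, `β'` with `Σ_{γ' ∈ Γ'} β'(γ'•x) = 1`
and `β` with `Σ_{γ ∈ Γ} β(γ•x) = 1` for all `x`, and `s i ∈ Γ` representatives of the right cosets
`Γ'\Γ` (`∀ γ ∈ Γ, ∃! i, γ (s i)⁻¹ ∈ Γ'`, `ι` countable). Then
`∫ F β' dν = ∫ (Σ_i F(s i • ·)) β dν` — the unfolding `∫_{Γ'\X} F = ∫_{Γ\X} Σ_{Γ'γ ∈ Γ'\Γ} F(γ ·)`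
(Cogdell (2004), §2.3: "replace … by its definition and unfold"). Proof: the right side is
`∫ F (unfoldWeight β s) dν` by the changes of variables `x ↦ (s i)⁻¹ • x`, and `unfoldWeight β s` is a
`Γ'`-weight (`coveringSum_unfoldWeight`), so the independence of the weight applies.
[cite: CogdellAnalyticTheory2004, §2.3] -/
theorem lintegral_mul_eq_lintegral_tsum_mul [Countable Γ] (hle : Γ' ≤ Γ) {F β' β : X → ℝ≥0∞}
    (hF : Measurable F) (hFinv : ∀ γ ∈ Γ', ∀ x : X, F (γ • x) = F x) (hβ' : Measurable β')
    (hβ'w : ∀ x, coveringSum Γ' β' x = 1) (hβ : Measurable β) (hβw : ∀ x, coveringSum Γ β x = 1)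
    {ι : Type*} [Countable ι] {s : ι → G} (hsΓ : ∀ i, s i ∈ Γ)
    (hs : ∀ γ ∈ Γ, ∃! i, γ * (s i)⁻¹ ∈ Γ') :
    ∫⁻ x, F x * β' x ∂ν = ∫⁻ x, (∑' i, F (s i • x)) * β x ∂ν := by
  haveI : Countable Γ' := by
    have hinj : Function.Injective (Subgroup.inclusion hle) := Subgroup.inclusion_injective hle
    exact hinj.countable
  have hw : ∀ x, coveringSum Γ' (unfoldWeight β s) x = 1 := fun x => by
    rw [coveringSum_unfoldWeight Γ Γ' hle β hsΓ hs x, hβw x]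
  have hFinv' : ∀ (γ : Γ') (x : X), F (γ • x) = F x := fun γ x => hFinv γ γ.2 x
  have step1 : ∫⁻ x, F x * β' x ∂ν = ∫⁻ x, F x * unfoldWeight β s x ∂ν :=
    lintegral_mul_eq_of_coveringSum_eq ν hF hFinv' hβ' (measurable_unfoldWeight hβ s)
      one_ne_zero ENNReal.one_ne_top hβ'w hw
  rw [step1]
  have hm : ∀ i, Measurable fun x => F (s i • x) * β x := fun i =>
    (hF.comp (measurable_const_smul (s i))).mul hβ
  calc ∫⁻ x, F x * unfoldWeight β s x ∂ν
      = ∫⁻ x, ∑' i, F x * β ((s i)⁻¹ • x) ∂ν := by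
        refine lintegral_congr fun x => ?_
        rw [unfoldWeight, ENNReal.tsum_mul_left]
    _ = ∑' i, ∫⁻ x, F x * β ((s i)⁻¹ • x) ∂ν :=
        lintegral_tsum fun i => (hF.mul (hβ.comp (measurable_const_smul (s i)⁻¹))).aemeasurable
    _ = ∑' i, ∫⁻ x, F (s i • x) * β x ∂ν := by
        refine tsum_congr fun i => ?_
        have hmi : Measurable fun x => F x * β ((s i)⁻¹ • x) :=
          hF.mul (hβ.comp (measurable_const_smul (s i)⁻¹))
        have h := (measurePreserving_smul (s i) ν).lintegral_comp hmi
        -- `h : ∫⁻ x, F (s i • x) * β ((s i)⁻¹ • s i • x) ∂ν = ∫⁻ x, F x * β ((s i)⁻¹ • x) ∂ν`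
        rw [← h]
        refine lintegral_congr fun x => ?_
        simp only [inv_smul_smul]
    _ = ∫⁻ x, ∑' i, F (s i • x) * β x ∂ν := (lintegral_tsum fun i => (hm i).aemeasurable).symm
    _ = ∫⁻ x, (∑' i, F (s i • x)) * β x ∂ν := by
        refine lintegral_congr fun x => ?_
        rw [ENNReal.tsum_mul_right]

end Unfolding

/-! ### The fibre functional of a group `Γ · U` and the independence of the weight -/

section Semidirect

variable {G : Type*} [Group G] {X : Type*} [MulAction G X] [MeasurableSpace X]
  [MeasurableSpace G] [MeasurableSMul₂ G X]
  (Γ U : Subgroup G) [Countable Γ] (μU : Measure U) [SFinite μU]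
  (ν : Measure X) [SFinite ν] [SMulInvariantMeasure G X ν]

/-- **The fibre functional of `Γ · U`**: `Σ_{γ ∈ Γ} ∫_U β(γ • u • x) dμU(u) ∈ [0, ∞]` for subgroups
`Γ, U ≤ G` of a group acting on `X` and a measure `μU` on `U` (for `Γ` discrete normalising the
closed subgroup `U` with Haar measure `μU`, this is the integral of `β` over the orbit of `x` under
the group `Γ U` for its Haar measure). [folklore] -/
def semidirectCoveringLIntegral (β : X → ℝ≥0∞) (x : X) : ℝ≥0∞ :=
  ∑' γ : Γ, ∫⁻ u : U, β ((γ : G) • (u : G) • x) ∂μU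

omit [MeasurableSpace X] [MeasurableSMul₂ G X] [Countable Γ] [SFinite μU] in
/-- Definitional unfolding. [folklore] -/
theorem semidirectCoveringLIntegral_apply (β : X → ℝ≥0∞) (x : X) :
    semidirectCoveringLIntegral Γ U μU β x = ∑' γ : Γ, ∫⁻ u : U, β ((γ : G) • (u : G) • x) ∂μU :=
  rfl

/-- Joint measurability of `(u, x) ↦ β(g • u • x)`. [folklore] -/
theorem measurable_comp_smul_smul {β : X → ℝ≥0∞} (hβ : Measurable β) (g : G) :
    Measurable fun p : U × X => β (g • (p.1 : G) • p.2) := by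
  have h1 : Measurable fun p : U × X => (p.1 : G) • p.2 :=
    (measurable_subtype_coe.comp measurable_fst).smul measurable_snd
  exact hβ.comp ((measurable_const.smul h1))

/-- **The exchange identity for `Γ · U`.** Let `F ≥ 0` be measurable and invariant under `Γ` and under
`U`, and `β₁, β₂ ≥ 0` measurable. Assume that `μU` is inversion invariant and that `Γ` and `U` commute
in the mean: `∫_U f(γ • u • x) dμU = ∫_U f(u • γ • x) dμU` (for `Γ` normalising `U` and `μU` invariant
under that conjugation). Then
`∫ F β₁ (Σ_γ ∫_U β₂(γ•u•·)) dν = ∫ F β₂ (Σ_γ ∫_U β₁(γ•u•·)) dν`.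
Proof: Tonelli, the change of variables `x ↦ (γ u)⁻¹ • x` (invariance of `ν` and of `F`), inversion
on `U`, `γ ↦ γ⁻¹`, and the commutation hypothesis. [folklore] -/
theorem lintegral_mul_mul_semidirectCoveringLIntegral_comm
    (hinv : ∀ f : U → ℝ≥0∞, Measurable f → ∫⁻ u, f u⁻¹ ∂μU = ∫⁻ u, f u ∂μU)
    (hcomm : ∀ (γ : Γ) (x : X) (f : X → ℝ≥0∞), Measurable f →
      ∫⁻ u : U, f ((γ : G) • (u : G) • x) ∂μU = ∫⁻ u : U, f ((u : G) • (γ : G) • x) ∂μU)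
    {F β₁ β₂ : X → ℝ≥0∞} (hF : Measurable F) (hFΓ : ∀ (γ : Γ) (x : X), F ((γ : G) • x) = F x)
    (hFU : ∀ (u : U) (x : X), F ((u : G) • x) = F x) (hβ₁ : Measurable β₁) (hβ₂ : Measurable β₂) :
    ∫⁻ x, F x * β₁ x * semidirectCoveringLIntegral Γ U μU β₂ x ∂ν =
      ∫⁻ x, F x * β₂ x * semidirectCoveringLIntegral Γ U μU β₁ x ∂ν := by
  -- measurability of the integrands
  have hmA : ∀ γ : Γ, Measurable fun p : X × U => F p.1 * β₁ p.1 * β₂ ((γ : G) • (p.2 : G) • p.1) := by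
    intro γ
    have h := (measurable_comp_smul_smul U hβ₂ (γ : G)).comp measurable_swap
    exact ((hF.comp measurable_fst).mul (hβ₁.comp measurable_fst)).mul h
  -- unfold the functional and bring everything under one sum and one double integral
  have lhs : ∫⁻ x, F x * β₁ x * semidirectCoveringLIntegral Γ U μU β₂ x ∂ν =
      ∑' γ : Γ, ∫⁻ u : U, ∫⁻ x, F x * β₁ x * β₂ ((γ : G) • (u : G) • x) ∂ν ∂μU := by
    calc ∫⁻ x, F x * β₁ x * semidirectCoveringLIntegral Γ U μU β₂ x ∂ν
        = ∫⁻ x, ∑' γ : Γ, ∫⁻ u : U, F x * β₁ x * β₂ ((γ : G) • (u : G) • x) ∂μU ∂ν := by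
          refine lintegral_congr fun x => ?_
          rw [semidirectCoveringLIntegral_apply, ← ENNReal.tsum_mul_left]
          refine tsum_congr fun γ => ?_
          have hmeas : Measurable fun u : U => β₂ ((γ : G) • (u : G) • x) :=
            (measurable_comp_smul_smul U hβ₂ (γ : G)).comp (measurable_id.prodMk measurable_const)
          rw [lintegral_const_mul (F x * β₁ x) hmeas]
      _ = ∑' γ : Γ, ∫⁻ x, ∫⁻ u : U, F x * β₁ x * β₂ ((γ : G) • (u : G) • x) ∂μU ∂ν :=
          lintegral_tsum fun γ => ((hmA γ).lintegral_prod_right').aemeasurable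
      _ = ∑' γ : Γ, ∫⁻ u : U, ∫⁻ x, F x * β₁ x * β₂ ((γ : G) • (u : G) • x) ∂ν ∂μU := by
          refine tsum_congr fun γ => ?_
          exact lintegral_lintegral_swap (hmA γ).aemeasurable
  have rhs : ∫⁻ x, F x * β₂ x * semidirectCoveringLIntegral Γ U μU β₁ x ∂ν =
      ∑' γ : Γ, ∫⁻ u : U, ∫⁻ x, F x * β₁ ((γ : G) • (u : G) • x) * β₂ x ∂ν ∂μU := by
    have hmC : ∀ γ : Γ, Measurable fun p : X × U =>
        F p.1 * β₁ ((γ : G) • (p.2 : G) • p.1) * β₂ p.1 := by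
      intro γ
      have h := (measurable_comp_smul_smul U hβ₁ (γ : G)).comp measurable_swap
      exact ((hF.comp measurable_fst).mul h).mul (hβ₂.comp measurable_fst)
    calc ∫⁻ x, F x * β₂ x * semidirectCoveringLIntegral Γ U μU β₁ x ∂ν
        = ∫⁻ x, ∑' γ : Γ, ∫⁻ u : U, F x * β₁ ((γ : G) • (u : G) • x) * β₂ x ∂μU ∂ν := by
          refine lintegral_congr fun x => ?_
          rw [semidirectCoveringLIntegral_apply, ← ENNReal.tsum_mul_left]
          refine tsum_congr fun γ => ?_
          have hmeas : Measurable fun u : U => β₁ ((γ : G) • (u : G) • x) :=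
            (measurable_comp_smul_smul U hβ₁ (γ : G)).comp (measurable_id.prodMk measurable_const)
          rw [← lintegral_const_mul (F x * β₂ x) hmeas]
          refine lintegral_congr fun u => ?_
          ring
      _ = ∑' γ : Γ, ∫⁻ x, ∫⁻ u : U, F x * β₁ ((γ : G) • (u : G) • x) * β₂ x ∂μU ∂ν :=
          lintegral_tsum fun γ => ((hmC γ).lintegral_prod_right').aemeasurable
      _ = ∑' γ : Γ, ∫⁻ u : U, ∫⁻ x, F x * β₁ ((γ : G) • (u : G) • x) * β₂ x ∂ν ∂μU := by
          refine tsum_congr fun γ => ?_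
          exact lintegral_lintegral_swap (hmC γ).aemeasurable
  rw [lhs, rhs]
  -- change variables `x ↦ (γ u)⁻¹ • x` in the left-hand side
  have cov : ∀ (γ : Γ) (u : U), ∫⁻ x, F x * β₁ x * β₂ ((γ : G) • (u : G) • x) ∂ν =
      ∫⁻ x, F x * β₁ (((u : G)⁻¹ * (γ : G)⁻¹) • x) * β₂ x ∂ν := by
    intro γ u
    have hm : Measurable fun x => F x * β₁ (((u : G)⁻¹ * (γ : G)⁻¹) • x) * β₂ x :=
      (hF.mul (hβ₁.comp (measurable_const_smul _))).mul hβ₂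
    rw [← (measurePreserving_smul ((γ : G) * (u : G)) ν).lintegral_comp hm]
    refine lintegral_congr fun x => ?_
    have e1 : ((u : G)⁻¹ * (γ : G)⁻¹) • ((γ : G) * (u : G)) • x = x := by
      rw [smul_smul, ← mul_inv_rev, inv_mul_cancel, one_smul]
    have e2 : F (((γ : G) * (u : G)) • x) = F x := by
      rw [← smul_smul, hFΓ, hFU]
    rw [e1, e2, ← smul_smul]
  simp_rw [cov]
  -- inversion on `U`: `β₁(u⁻¹ γ⁻¹ • x)` becomes `β₁(u γ⁻¹ • x)`
  have stepU : ∀ γ : Γ, ∫⁻ u : U, ∫⁻ x, F x * β₁ (((u : G)⁻¹ * (γ : G)⁻¹) • x) * β₂ x ∂ν ∂μU =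
      ∫⁻ u : U, ∫⁻ x, F x * β₁ ((u : G) • ((γ⁻¹ : Γ) : G) • x) * β₂ x ∂ν ∂μU := by
    intro γ
    have hm : Measurable fun u : U => ∫⁻ x, F x * β₁ ((u : G) • ((γ⁻¹ : Γ) : G) • x) * β₂ x ∂ν := by
      have h1 : Measurable fun p : U × X => β₁ ((p.1 : G) • ((γ⁻¹ : Γ) : G) • p.2) :=
        hβ₁.comp ((measurable_subtype_coe.comp measurable_fst).smul
          ((measurable_const_smul _).comp measurable_snd))
      exact (((hF.comp measurable_snd).mul h1).mul (hβ₂.comp measurable_snd)).lintegral_prod_right'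
    rw [← hinv _ hm]
    refine lintegral_congr fun u => lintegral_congr fun x => ?_
    simp only [Subgroup.coe_inv, smul_smul]
  simp_rw [stepU]
  -- reindex `γ ↦ γ⁻¹`
  rw [← (Equiv.inv Γ).tsum_eq (fun γ : Γ =>
    ∫⁻ u : U, ∫⁻ x, F x * β₁ ((γ : G) • (u : G) • x) * β₂ x ∂ν ∂μU)]
  simp only [Equiv.inv_apply]
  -- commute `γ⁻¹` and `u` in the mean, after exchanging the two integrals
  refine tsum_congr fun γ => ?_
  have hA : Measurable fun p : U × X => F p.2 * β₁ ((p.1 : G) • ((γ⁻¹ : Γ) : G) • p.2) * β₂ p.2 := by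
    have h1 : Measurable fun p : U × X => β₁ ((p.1 : G) • ((γ⁻¹ : Γ) : G) • p.2) :=
      hβ₁.comp ((measurable_subtype_coe.comp measurable_fst).smul
        ((measurable_const_smul _).comp measurable_snd))
    exact ((hF.comp measurable_snd).mul h1).mul (hβ₂.comp measurable_snd)
  have hB : Measurable fun p : X × U => F p.1 * β₁ (((γ⁻¹ : Γ) : G) • (p.2 : G) • p.1) * β₂ p.1 := by
    have h1 := (measurable_comp_smul_smul U hβ₁ (((γ⁻¹ : Γ) : G))).comp measurable_swap
    exact ((hF.comp measurable_fst).mul h1).mul (hβ₂.comp measurable_fst)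
  calc ∫⁻ u : U, ∫⁻ x, F x * β₁ ((u : G) • ((γ⁻¹ : Γ) : G) • x) * β₂ x ∂ν ∂μU
      = ∫⁻ x, ∫⁻ u : U, F x * β₁ ((u : G) • ((γ⁻¹ : Γ) : G) • x) * β₂ x ∂μU ∂ν :=
        lintegral_lintegral_swap hA.aemeasurable
    _ = ∫⁻ x, ∫⁻ u : U, F x * β₁ (((γ⁻¹ : Γ) : G) • (u : G) • x) * β₂ x ∂μU ∂ν := by
        refine lintegral_congr fun x => ?_
        have key := hcomm γ⁻¹ x (fun y => F x * β₁ y * β₂ x)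
          ((measurable_const.mul hβ₁).mul measurable_const)
        exact key.symm
    _ = ∫⁻ u : U, ∫⁻ x, F x * β₁ (((γ⁻¹ : Γ) : G) • (u : G) • x) * β₂ x ∂ν ∂μU :=
        lintegral_lintegral_swap hB.aemeasurable

/-- **Independence of the weight for `Γ · U`.** Under the hypotheses of the exchange identity, if
`β₁, β₂ ≥ 0` are measurable with the same constant fibre functional `c ∈ (0, ∞)` —
`Σ_γ ∫_U β₁(γ•u•x) = Σ_γ ∫_U β₂(γ•u•x) = c` for all `x` — then `∫ F β₁ dν = ∫ F β₂ dν` for every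
measurable `F ≥ 0` invariant under `Γ` and `U`: `∫_X F β dν` is an integral over `(Γ U)\X`.
[folklore] -/
theorem lintegral_mul_eq_of_semidirectCoveringLIntegral_eq
    (hinv : ∀ f : U → ℝ≥0∞, Measurable f → ∫⁻ u, f u⁻¹ ∂μU = ∫⁻ u, f u ∂μU)
    (hcomm : ∀ (γ : Γ) (x : X) (f : X → ℝ≥0∞), Measurable f →
      ∫⁻ u : U, f ((γ : G) • (u : G) • x) ∂μU = ∫⁻ u : U, f ((u : G) • (γ : G) • x) ∂μU)
    {F β₁ β₂ : X → ℝ≥0∞} (hF : Measurable F) (hFΓ : ∀ (γ : Γ) (x : X), F ((γ : G) • x) = F x)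
    (hFU : ∀ (u : U) (x : X), F ((u : G) • x) = F x) (hβ₁ : Measurable β₁) (hβ₂ : Measurable β₂)
    {c : ℝ≥0∞} (hc₀ : c ≠ 0) (hc : c ≠ ∞) (h₁ : ∀ x, semidirectCoveringLIntegral Γ U μU β₁ x = c)
    (h₂ : ∀ x, semidirectCoveringLIntegral Γ U μU β₂ x = c) :
    ∫⁻ x, F x * β₁ x ∂ν = ∫⁻ x, F x * β₂ x ∂ν := by
  have key := lintegral_mul_mul_semidirectCoveringLIntegral_comm Γ U μU ν hinv hcomm hF hFΓ hFU hβ₁ hβ₂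
  simp only [h₁, h₂] at key
  have e₁ : ∫⁻ x, F x * β₁ x * c ∂ν = (∫⁻ x, F x * β₁ x ∂ν) * c :=
    lintegral_mul_const c (hF.mul hβ₁)
  have e₂ : ∫⁻ x, F x * β₂ x * c ∂ν = (∫⁻ x, F x * β₂ x ∂ν) * c :=
    lintegral_mul_const c (hF.mul hβ₂)
  rw [e₁, e₂] at key
  exact (ENNReal.mul_left_inj hc₀ hc).1 key

end Semidirect

end Literature.MeasureTheory.Group
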